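import Summits.ResolutionOfSingularities.ResolutionOfSingularities.Theorems.HilbertSamuelEliminationSigmaMaxModificationsCorridor3WLadderIsoTailsFreeRationalArcLimit
import Summits.ResolutionOfSingularities.ResolutionOfSingularities.Theorems.HilbertSamuelEliminationSigmaMaxModificationsCorridor3WLadderIsoTailsFreeRationalLow
import HarnessLib

/-!
# [OURS · L1 W4.2] D14 ROUTE G v2 «ARC LIMIT» — **K1 WITHOUT THE GRADE, EVERY EMBEDDING DIMENSION**: a point tower of any directrix grade
# `ē ≥ 1` over a maximal origin, ISOLATED AT STAGE `1`, cannot have all its steps rational and non-satellite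
# (crux `SigmaMaxModifications` stmt-ResolutionOfSingularities-18506 / conjunct stmt-…-19249; line `w_ladder_rows` v8.5, row `stub_twoClaims` (β),
# the `e = 1` third door; `--supports stmt-…-19249`, helper)

Stub worker res-L1-w42-stub-3 (gen 6). Sorry-free PROOF file, no definition, no named fact. OURS (cell res-hironaka, slot W4.2);
NOT statements of [Hironaka2017] nor of [CossartJannsenSaito2020] / [CossartPiltant2009]. AI-written; AI review is weaker than expert review.

res-L1-w42-stub-2's final assembly `IsoTailsHS.false_of_isIsoPointTower_of_forall_freeRational` (p-landed, `…IsoTailsFreeRationalArcLimit`: K1 in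
EVERY embedding dimension) is stated for `IsIsoPointTower 3 ν T pt`, whose last two conjuncts are «isolated at EVERY stage» and the W-top grade
«`3 ≤ ē` at every stage». Its proof reads the grade only through `IsIsoPointTower.isMaximalOrigin` (where `1 ≤ ē` suffices: the marked closed
point is a permissible centre) and isolation only at the ONE stage `n₀ = 1` where H∞-FINAL-G is applied — exactly as the edim-4 predecessor did
(`…IsoTailsFreeRationalLow`, p535876). This file RE-RUNS the same proof on an UNBUNDLED point tower `(hC, hπ, hcl, hν)` with `∀ n, 1 ≤ ē_{x_n}` and
isolation at stage `1` only, so that the `e = 1` door of the W-low rows (`e = 1 ≤ ē ≤ 2`) can dock at it in every embedding dimension: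

* `IsoTailsHS.false_of_pointTower_of_stage_of_bennettArc` — H∞-FINAL-G (binder form, res-type-001 p533299) unbundled: isolation at `n₀` only;
* **`IsoTailsHS.false_of_pointTower_of_forall_freeRational`** — K1 from stage `0`, every edim, every grade `ē ≥ 1`, isolation at stage `1` only.

Every lemma of the chain (stub-2's `exists_regular_presentation_stalk_with_coefficientField`, `exists_free_index_of_eq`, `exists_bennettArc_of_frameTower`,
res-type-038's `FormalFrame.exists_baseFrame_of_rsop`, res-type-071's `FormalFrameGen.exists_frameStep_ideal`, lead-1's `ArcLimit.*`, H1
`hilbertSamuelFun_stalk_eq_of_tower`) is consumed BY NAME; nothing of theirs is restated. [OURS · L1 W4.2; AI-written]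
[cite: CossartPiltant2009, ch. 3 I.9] [cite: HerrmannIkedaOrbanz1988, Thm. (22.24)] [cite: CossartJannsenSaito2020, Def. 6.34, Cor. 6.37]
-/

set_option linter.dupNamespace false

noncomputable section

open CategoryTheory AlgebraicGeometry TopologicalSpace IsLocalRing MvPowerSeries
open Literature.AlgebraicGeometry.Resolution Literature.RingTheory.HilbertSamuel
open Literature.AlgebraicGeometry.CossartJannsenSaito2020
open Summit.ResolutionOfSingularities.ResolutionOfSingularities.Theorems.CampaignW42
open Summit.ResolutionOfSingularities.ResolutionOfSingularities.Theorems.SigmaMaxModificationsCorridor3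
open Summit.ResolutionOfSingularities.ResolutionOfSingularities.Cruxes.SigmaMaxModifications
open Summit.ResolutionOfSingularities.ResolutionOfSingularities.Cruxes.SigmaMaxModifications.IdeasL1C4
open Summit.ResolutionOfSingularities.ResolutionOfSingularities.Cruxes.SigmaMaxModifications.IdeasL1Idea2R4
open Summit.ResolutionOfSingularities.ResolutionOfSingularities.Cruxes.SigmaMaxModifications.IdeasL1C5

namespace Summit.ResolutionOfSingularities.ResolutionOfSingularities.Theorems.SigmaMaxModificationsCorridor3.IsoTailsHS

universe u

variable {p : ℕ} {ν : ℕ → ℕ} {T : BlowupTower.{u}} {pt : ∀ n, T.X n}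

/-- **H∞-FINAL-G (binder form), UNBUNDLED**: no Bennett arc in a formal model of a stage `n₀` of a point tower of grade `ē ≥ 1` over a maximal
origin, `x_{n₀}` isolated in `(X_{n₀})_max` — res-type-001's `false_of_isIsoPointTower_of_stage_of_bennettArc` with `IsIsoPointTower` replaced by
`(hC, hcl, hν, 1 ≤ ē)` and isolation at `n₀` only (`isIsolatedInHSMaxLocus_spec_stalk_of_pointTower`, p535876). [OURS · L1 W4.2; AI-written]
[cite: CossartJannsenSaito2020, Def. 13.3, Thm. 3.3] [cite: HerrmannIkedaOrbanz1988, Thm. (22.24)] -/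
theorem false_of_pointTower_of_stage_of_bennettArc (hC : ∀ n, T.C n = {pt n}) (hcl : ∀ n, IsClosed ({pt n} : Set (T.X n)))
    (hν : ∀ n, Scheme.hsFun (T.X n) 3 (pt n) = ν) (he : ∀ n, 1 ≤ @Scheme.geomDirDim (T.X n) (T.ln n) (pt n))
    (hO : IsMaximalOrigin p 3 ν (T.X 0) (pt 0)) (n₀ : ℕ) (hiso : @IsIsolatedInHSMaxLocus (T.X n₀) (T.ln n₀) 3 (pt n₀))
    {R : Type u} [CommRing R] [IsRegularLocalRing R] (I : Ideal R) (e : ↥((T.X n₀).presheaf.stalk (pt n₀)) ≃+* R ⧸ I)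
    {S : Type u} [CommRing S] [IsRegularLocalRing S] (J : Ideal S) [IsLocalRing (S ⧸ J)]
    (e' : (S ⧸ J) ≃+* AdicCompletion (maximalIdeal ↥((T.X n₀).presheaf.stalk (pt n₀))) ↥((T.X n₀).presheaf.stalk (pt n₀)))
    (P : Ideal S) [P.IsPrime] [IsRegularLocalRing (S ⧸ P)] (hP1 : ringKrullDim (S ⧸ P) = (1 : ℕ)) (hJP : J ≤ P)
    [(P.map (Ideal.Quotient.mk J)).IsPrime]
    (hH : hilbertSamuelFun (Localization.AtPrime (P.map (Ideal.Quotient.mk J))) 1 = hilbertFun (S ⧸ J)) : False := by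
  haveI : IsLocallyNoetherian (T.X n₀) := T.ln n₀
  -- (1)+(2): isolation in `Spec 𝒪̂`
  have hexc : Scheme.IsExcellent (T.X n₀) := isExcellent_X T (isExcellent_of_isMaximalOrigin hO) n₀
  have hA : IsExcellentRing ((T.X n₀).presheaf.stalk (pt n₀)) := isExcellentRing_stalk_of_isExcellent hexc (pt n₀)
  have hdim : ringKrullDim ((T.X n₀).presheaf.stalk (pt n₀)) ≤ ((3 : ℕ) : WithBot ℕ∞) :=
    ringKrullDim_stalk_le T hO.dim_le n₀ (pt n₀)
  have hisoS := isIsolatedInHSMaxLocus_spec_stalk_of_pointTower hC hcl hν he hO n₀ hiso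
  have hisoC := isIsolatedInHSMaxLocus_adicCompletion_of_ringEquiv ((T.X n₀).presheaf.stalk (pt n₀)) hA I e 3 hdim hisoS
  -- (3): transport to `Spec (S ⧸ J)`
  have hisoS' : IsIsolatedInHSMaxLocus (Spec (CommRingCat.of (S ⧸ J))) 3 (closedPoint (S ⧸ J)) :=
    Moving.isIsolatedInHSMaxLocus_spec_of_iso
      (A := CommRingCat.of (AdicCompletion (maximalIdeal ↥((T.X n₀).presheaf.stalk (pt n₀))) ↥((T.X n₀).presheaf.stalk (pt n₀))))
      (B := CommRingCat.of (S ⧸ J)) e'.symm.toCommRingCatIso 3 hisoC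
  -- (4): the ROUTE-G end on `S ⧸ J`
  have hcat : IsCatenaryRing (S ⧸ J) := (isCatenaryRing_of_isRegularLocalRing S).quotient J
  let q : (S ⧸ J) ⧸ P.map (Ideal.Quotient.mk J) ≃+* S ⧸ P := DoubleQuot.quotQuotEquivQuotOfLE hJP
  haveI : IsRegularLocalRing ((S ⧸ J) ⧸ P.map (Ideal.Quotient.mk J)) := IsRegularLocalRing.of_ringEquiv q.symm
  have hr : ringKrullDim ((S ⧸ J) ⧸ P.map (Ideal.Quotient.mk J)) = (1 : ℕ) := by
    rw [ringKrullDim_eq_of_ringEquiv q, hP1]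
  have hPm : P.map (Ideal.Quotient.mk J) ≠ maximalIdeal (S ⧸ J) := by
    intro heq
    have hdim1 : ringKrullDim ((S ⧸ J) ⧸ maximalIdeal (S ⧸ J)) = (1 : ℕ) := heq ▸ hr
    letI := Ideal.Quotient.field (maximalIdeal (S ⧸ J))
    rw [ringKrullDim_eq_zero_of_field] at hdim1
    exact absurd hdim1 (by norm_num)
  have hN : minimalPrimesCodim (S ⧸ J) ≤ 3 := by
    have h1 := minimalPrimesCodim_le_ringKrullDim (S ⧸ J)
    rw [ringKrullDim_eq_of_ringEquiv e', ringKrullDim_adicCompletion] at h1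
    exact_mod_cast h1.trans hdim
  exact not_isIsolatedInHSMaxLocus_closedPoint_of_hilbertSamuelFun_eq' hcat (P.map (Ideal.Quotient.mk J)) hPm hr hH hN hisoS'

set_option maxHeartbeats 3200000 in
-- the stage invariant is a long conjunction over stalks (verbatim from `…IsoTailsFreeRationalArcLimit`)
/-- **K1 FROM STAGE `0`, EVERY EMBEDDING DIMENSION, EVERY GRADE `ē ≥ 1`, ISOLATION AT STAGE `1` ONLY.** A point tower at level `3` over a maximal
origin of characteristic `p` (`C_n = {x_n}`, `π_n x_{n+1} = x_n`, `x_n` closed, `H^3(x_n) = ν`, `1 ≤ ē_{x_n}`), with `x_1` isolated in `(X_1)_max`,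
cannot have ALL its steps rational and non-satellite — stub-2's steps 1–6 verbatim on the unbundled tower. [OURS · L1 W4.2; AI-written]
[cite: CossartPiltant2009, ch. 3 I.9] [cite: HerrmannIkedaOrbanz1988, Thm. (22.24)] [cite: CossartJannsenSaito2020, Def. 6.34, Cor. 6.37] -/
theorem false_of_pointTower_of_forall_freeRational (hC : ∀ n, T.C n = {pt n}) (hpt : ∀ n, (T.π n).base (pt (n + 1)) = pt n)
    (hcl : ∀ n, IsClosed ({pt n} : Set (T.X n))) (hν : ∀ n, Scheme.hsFun (T.X n) 3 (pt n) = ν)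
    (he : ∀ n, 1 ≤ @Scheme.geomDirDim (T.X n) (T.ln n) (pt n)) (hO : IsMaximalOrigin p 3 ν (T.X 0) (pt 0))
    (hiso1 : @IsIsolatedInHSMaxLocus (T.X 1) (T.ln 1) 3 (pt 1))
    (hrat : ∀ n, IsRationalStep T pt n) (hnsat : ∀ n, ¬ IsSatelliteStep T pt n) : False := by
  classical
  haveI : ∀ n, IsLocallyNoetherian (T.X n) := T.ln
  -- (1) a presentation with a coefficient field at stage `0`
  obtain ⟨k, _, _, g, -, hft, -⟩ := hO.exists_structure
  haveI := hft
  obtain ⟨R₀, _, _, k₀, hk₀, σ₀, hσ₀⟩ := exists_regular_presentation_stalk_with_coefficientField g (pt 0)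
  -- (2) a regular system of parameters with (FREE)₀ at index `0`
  obtain ⟨c₀, hc₀⟩ := exists_regularSystemOfParameters (R := R₀)
  obtain ⟨j, hj⟩ := exists_free_index_of_eq (T.isBlowup 0) (pt 1) (pt 0) (hpt 0)
    (EmbeddedStep.stalkIdeal_centreIdeal_eq_maximalIdeal T pt 0 (hC 0) (hcl 0)) rfl c₀ hc₀ σ₀ hσ₀
  -- the embedding dimension is positive: write it as `d + 1`
  obtain ⟨d, hd⟩ : ∃ d, (maximalIdeal R₀).spanFinrank = d + 1 :=
    ⟨(maximalIdeal R₀).spanFinrank - 1, (Nat.succ_pred_eq_of_pos (Fin.pos j)).symm⟩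
  let c : Fin (d + 1) → R₀ := c₀ ∘ finCongr hd.symm
  have hc : Ideal.span (Set.range c) = maximalIdeal R₀ := by
    rw [(finCongr hd.symm).surjective.range_comp]; exact hc₀
  let j' : Fin (d + 1) := finCongr hd j
  have hj' : ∀ i, ((T.π 0).stalkMap (pt (0 + 1))).hom (((T.X 0).presheaf.stalkCongr (.of_eq (hpt 0))).inv (σ₀ (c j'))) ∣
      ((T.π 0).stalkMap (pt (0 + 1))).hom (((T.X 0).presheaf.stalkCongr (.of_eq (hpt 0))).inv (σ₀ (c i))) := fun i => by
    have h := hj (finCongr hd.symm i)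
    simpa [c, j'] using h
  let x : Fin (d + 1) → R₀ := c ∘ Equiv.swap 0 j'
  have hx : Ideal.span (Set.range x) = maximalIdeal R₀ := by
    rw [(Equiv.swap (0 : Fin (d + 1)) j').surjective.range_comp]; exact hc
  have hfree : ∀ i, ((T.π 0).stalkMap (pt (0 + 1))).hom (((T.X 0).presheaf.stalkCongr (.of_eq (hpt 0))).inv (σ₀ (x 0))) ∣
      ((T.π 0).stalkMap (pt (0 + 1))).hom (((T.X 0).presheaf.stalkCongr (.of_eq (hpt 0))).inv (σ₀ (x i))) := fun i => by
    show ((T.π 0).stalkMap (pt (0 + 1))).hom (((T.X 0).presheaf.stalkCongr (.of_eq (hpt 0))).inv (σ₀ (c (Equiv.swap 0 j' 0)))) ∣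
      ((T.π 0).stalkMap (pt (0 + 1))).hom (((T.X 0).presheaf.stalkCongr (.of_eq (hpt 0))).inv (σ₀ (c (Equiv.swap 0 j' i))))
    rw [Equiv.swap_apply_left]
    exact hj' _
  -- (3) the base frame
  obtain ⟨_, -, ψ₀, -, -, -, -, hloc₀, hψx, hres₀⟩ := FormalFrame.exists_baseFrame_of_rsop R₀ k₀ hk₀ hd x hx
  haveI := hloc₀
  set κ := ResidueField (AdicCompletion (maximalIdeal R₀) R₀) with hκ
  -- (4) THE ITERATION. Stage invariant:
  obtain ⟨P, hP⟩ : ∃ P : ∀ (n : ℕ) (S : Type u) [CommRing S] [IsRegularLocalRing S], (Fin (d + 1) → S) →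
      (S →+* (T.X n).presheaf.stalk (pt n)) → (S →+* MvPowerSeries (Fin (d + 1)) κ) → (Fin (d + 1) → κ) → Prop,
      P = fun (n : ℕ) (S : Type u) [CommRing S] [IsRegularLocalRing S] (y : Fin (d + 1) → S)
          (τ : S →+* (T.X n).presheaf.stalk (pt n)) (φ : S →+* MvPowerSeries (Fin (d + 1)) κ) (l : Fin (d + 1) → κ) =>
        (maximalIdeal S).spanFinrank = d + 1 ∧ Ideal.span (Set.range y) = maximalIdeal S ∧ Function.Surjective τ ∧
        (∀ i, ((T.π n).stalkMap (pt (n + 1))).hom (((T.X n).presheaf.stalkCongr (.of_eq (hpt n))).inv (τ (y 0))) ∣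
          ((T.π n).stalkMap (pt (n + 1))).hom (((T.X n).presheaf.stalkCongr (.of_eq (hpt n))).inv (τ (y i)))) ∧
        IsLocalHom φ ∧ φ (y 0) = X 0 ∧
        (∀ i, i ≠ 0 → φ (y i) - X i - C (l i) * X 0 ∈ maximalIdeal (MvPowerSeries (Fin (d + 1)) κ) ^ 2) ∧
        (∀ a : κ, ∃ r : S, φ r - C a ∈ maximalIdeal (MvPowerSeries (Fin (d + 1)) κ)) := ⟨_, rfl⟩
  -- the link between consecutive stages: the frame commutation, the kernel link, the saturation of the new kernel
  obtain ⟨L, hL⟩ : ∃ L : ∀ (n : ℕ) (S : Type u) [CommRing S] (S' : Type u) [CommRing S'],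
      (S →+* (T.X n).presheaf.stalk (pt n)) → (S' →+* (T.X (n + 1)).presheaf.stalk (pt (n + 1))) →
      (S →+* MvPowerSeries (Fin (d + 1)) κ) → (S' →+* MvPowerSeries (Fin (d + 1)) κ) → (Fin (d + 1) → S') → Prop,
      L = fun (n : ℕ) (S : Type u) [CommRing S] (S' : Type u) [CommRing S'] (τ : S →+* (T.X n).presheaf.stalk (pt n))
          (τ' : S' →+* (T.X (n + 1)).presheaf.stalk (pt (n + 1)))
          (φ : S →+* MvPowerSeries (Fin (d + 1)) κ) (φ' : S' →+* MvPowerSeries (Fin (d + 1)) κ) (y' : Fin (d + 1) → S') =>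
        ∃ (ι : S →+* S') (c₁ : Fin (d + 1) → κ), (∀ r, φ' (ι r) = subst (SeriesGen.transChartSubst c₁) (φ r)) ∧
          (RingHom.ker τ).map ι ≤ RingHom.ker τ' ∧ (∀ r, y' 0 * r ∈ RingHom.ker τ' → r ∈ RingHom.ker τ') := ⟨_, rfl⟩
  -- the state space
  obtain ⟨St, hSt⟩ : ∃ St : ℕ → Type (u + 1), St = fun n =>
      Σ' (S : Type u) (i : CommRing S) (j : IsRegularLocalRing S) (y : Fin (d + 1) → S) (τ : S →+* (T.X n).presheaf.stalk (pt n))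
        (φ : S →+* MvPowerSeries (Fin (d + 1)) κ) (l : Fin (d + 1) → κ), @P n S i j y τ φ l := ⟨_, rfl⟩
  subst hSt
  -- the step (res-type-071's frame link)
  have hstep : ∀ n (s : (fun n => Σ' (S : Type u) (i : CommRing S) (j : IsRegularLocalRing S) (y : Fin (d + 1) → S)
      (τ : S →+* (T.X n).presheaf.stalk (pt n)) (φ : S →+* MvPowerSeries (Fin (d + 1)) κ) (l : Fin (d + 1) → κ),
      @P n S i j y τ φ l) n),
      ∃ s' : (fun n => Σ' (S : Type u) (i : CommRing S) (j : IsRegularLocalRing S) (y : Fin (d + 1) → S)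
        (τ : S →+* (T.X n).presheaf.stalk (pt n)) (φ : S →+* MvPowerSeries (Fin (d + 1)) κ) (l : Fin (d + 1) → κ),
        @P n S i j y τ φ l) (n + 1),
        @L n s.1 s.2.1 s'.1 s'.2.1 s.2.2.2.2.1 s'.2.2.2.2.1 s.2.2.2.2.2.1 s'.2.2.2.2.2.1 s'.2.2.2.1 := by
    intro n s
    obtain ⟨S, i, j, y, τ, φ, l, hPn⟩ := s
    rw [hP] at hPn
    obtain ⟨h1, h2, h3, h4, h5, h6, h7, h8⟩ := hPn
    haveI := h5
    obtain ⟨R', i', j', x', σ', ψ', lam', ι, c₁, hr⟩ :=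
      FormalFrameGen.exists_frameStep_ideal T pt n (hC n) (hcl n) (hpt n) (hpt (n + 1)) (hrat n) (hnsat n) h1 y h2 τ h3 h4 φ h6 l
        h7 h8
    have hP' : @P (n + 1) R' i' j' x' σ' ψ' lam' := by
      rw [hP]
      exact ⟨hr.1, hr.2.1, hr.2.2.1, hr.2.2.2.2.2.2.2.2.1, hr.2.2.2.2.2.2.2.2.2.1, hr.2.2.2.2.2.2.2.2.2.2.1, hr.2.2.2.2.2.2.2.2.2.2.2.1,
        hr.2.2.2.2.2.2.2.2.2.2.2.2.1⟩
    have hL' : @L n S i R' i' τ σ' φ ψ' x' := by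
      rw [hL]
      exact ⟨ι, c₁, hr.2.2.2.2.2.2.2.2.2.2.2.2.2, hr.2.2.2.1, hr.2.2.2.2.1⟩
    exact ⟨⟨R', i', j', x', σ', ψ', lam', hP'⟩, hL'⟩
  -- the base stage
  have hP0 : @P 0 R₀ _ _ x σ₀ ψ₀ (fun _ => 0) := by
    rw [hP]
    refine ⟨hd, hx, hσ₀, hfree, hloc₀, hψx 0, fun i _ => ?_, hres₀⟩
    rw [hψx i, map_zero, zero_mul, sub_self, sub_zero]
    exact Ideal.zero_mem _
  -- the recursion (choice)
  obtain ⟨st, hst0, hst⟩ : ∃ st : ∀ n, (fun n => Σ' (S : Type u) (i : CommRing S) (j : IsRegularLocalRing S) (y : Fin (d + 1) → S)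
      (τ : S →+* (T.X n).presheaf.stalk (pt n)) (φ : S →+* MvPowerSeries (Fin (d + 1)) κ) (l : Fin (d + 1) → κ),
      @P n S i j y τ φ l) n,
      st 0 = ⟨R₀, inferInstance, inferInstance, x, σ₀, ψ₀, fun _ => 0, hP0⟩ ∧
        ∀ n, st (n + 1) = Classical.choose (hstep n (st n)) :=
    ⟨fun n => Nat.rec (motive := fun n => (fun n => Σ' (S : Type u) (i : CommRing S) (j : IsRegularLocalRing S)
        (y : Fin (d + 1) → S) (τ : S →+* (T.X n).presheaf.stalk (pt n)) (φ : S →+* MvPowerSeries (Fin (d + 1)) κ)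
        (l : Fin (d + 1) → κ), @P n S i j y τ φ l) n)
      ⟨R₀, inferInstance, inferInstance, x, σ₀, ψ₀, fun _ => 0, hP0⟩ (fun n s => Classical.choose (hstep n s)) n,
      rfl, fun n => rfl⟩
  letI : ∀ n, CommRing (st n).1 := fun n => (st n).2.1
  letI : ∀ n, IsRegularLocalRing (st n).1 := fun n => (st n).2.2.1
  have hlink : ∀ n, ∃ (ι : (st n).1 →+* (st (n + 1)).1) (c₁ : Fin (d + 1) → κ),
      (∀ r, (st (n + 1)).2.2.2.2.2.1 (ι r) = subst (SeriesGen.transChartSubst c₁) ((st n).2.2.2.2.2.1 r)) ∧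
        (RingHom.ker (st n).2.2.2.2.1).map ι ≤ RingHom.ker (st (n + 1)).2.2.2.2.1 ∧
        (∀ r, (st (n + 1)).2.2.2.1 0 * r ∈ RingHom.ker (st (n + 1)).2.2.2.2.1 → r ∈ RingHom.ker (st (n + 1)).2.2.2.2.1) := by
    intro n
    have hs := Classical.choose_spec (hstep n (st n))
    rw [← hst n, hL] at hs
    exact hs
  choose ι c₁ hcomm hker hsat using hlink
  -- read off the stage clauses (generalised over the state, so that `P` can be unfolded)
  have hPt : ∀ (n : ℕ) (S : Type u) [CommRing S] [IsRegularLocalRing S] (y : Fin (d + 1) → S)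
      (τ : S →+* (T.X n).presheaf.stalk (pt n)) (φ : S →+* MvPowerSeries (Fin (d + 1)) κ) (l : Fin (d + 1) → κ),
      @P n S _ _ y τ φ l →
        (maximalIdeal S).spanFinrank = d + 1 ∧ Ideal.span (Set.range y) = maximalIdeal S ∧ Function.Surjective τ ∧
        IsLocalHom φ ∧ φ (y 0) = X 0 ∧
        (∀ i, i ≠ 0 → φ (y i) - X i - C (l i) * X 0 ∈ maximalIdeal (MvPowerSeries (Fin (d + 1)) κ) ^ 2) ∧
        (∀ a : κ, ∃ r : S, φ r - C a ∈ maximalIdeal (MvPowerSeries (Fin (d + 1)) κ)) := by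
    intro n S _ _ y τ φ l hq
    rw [hP] at hq
    exact ⟨hq.1, hq.2.1, hq.2.2.1, hq.2.2.2.2.1, hq.2.2.2.2.2.1, hq.2.2.2.2.2.2.1, hq.2.2.2.2.2.2.2⟩
  have hclauses : ∀ n, (maximalIdeal (st n).1).spanFinrank = d + 1 ∧
      Ideal.span (Set.range (st n).2.2.2.1) = maximalIdeal (st n).1 ∧ Function.Surjective (st n).2.2.2.2.1 ∧
      IsLocalHom (st n).2.2.2.2.2.1 ∧ (st n).2.2.2.2.2.1 ((st n).2.2.2.1 0) = X 0 ∧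
      (∀ i, i ≠ 0 → (st n).2.2.2.2.2.1 ((st n).2.2.2.1 i) - X i - C ((st n).2.2.2.2.2.2.1 i) * X 0 ∈
        maximalIdeal (MvPowerSeries (Fin (d + 1)) κ) ^ 2) ∧
      (∀ a : κ, ∃ r : (st n).1, (st n).2.2.2.2.2.1 r - C a ∈ maximalIdeal (MvPowerSeries (Fin (d + 1)) κ)) := fun n =>
    @hPt n (st n).1 (st n).2.1 (st n).2.2.1 (st n).2.2.2.1 (st n).2.2.2.2.1 (st n).2.2.2.2.2.1 (st n).2.2.2.2.2.2.1
      (st n).2.2.2.2.2.2.2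
  -- (5) part 2 on the stages `≥ 1`
  haveI : ∀ n, IsLocalHom (st (n + 1)).2.2.2.2.2.1 := fun n => (hclauses (n + 1)).2.2.2.1
  have hexc : Scheme.IsExcellent (T.X 0) := isExcellent_of_isMaximalOrigin hO
  have hHS : ∀ n, hilbertFun ((T.X (n + 1)).presheaf.stalk (pt (n + 1))) = hilbertFun ((T.X (0 + 1)).presheaf.stalk (pt (0 + 1))) := by
    intro n
    have h1 := hilbertSamuelFun_stalk_eq_of_tower hexc hO.dim_le hpt hcl hν (n + 1) 0
    have h2 := hilbertSamuelFun_stalk_eq_of_tower hexc hO.dim_le hpt hcl hν (0 + 1) 0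
    simp only [hilbertSamuelFun_zero] at h1 h2
    rw [h1, h2]
  obtain ⟨J, hJloc, e', hJP', hJP, hH⟩ :=
    exists_bennettArc_of_frameTower (K := κ) (d := d) (fun n => (st (n + 1)).1) (fun n => (hclauses (n + 1)).1)
      (fun n => (st (n + 1)).2.2.2.1) (fun n => (hclauses (n + 1)).2.1)
      (fun n => (T.X (n + 1)).presheaf.stalk (pt (n + 1))) (fun n => (st (n + 1)).2.2.2.2.1) (fun n => (hclauses (n + 1)).2.2.1)
      (fun n => hsat n) (fun n => (st (n + 1)).2.2.2.2.2.1) (fun n => (hclauses (n + 1)).2.2.2.2.1)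
      (fun n => (st (n + 1)).2.2.2.2.2.2.1) (fun n => (hclauses (n + 1)).2.2.2.2.2.1) (fun n => (hclauses (n + 1)).2.2.2.2.2.2)
      (fun n => ι (n + 1)) c₁ (fun n r => hcomm (n + 1) r) (fun n => hker (n + 1)) hHS
  -- (6) H∞-FINAL-G (unbundled) at stage `1`, along `P₀`
  haveI := hJloc
  haveI := hJP'
  haveI : IsRegularLocalRing (MvPowerSeries (Fin (d + 1)) κ) := isRegularLocalRing_mvPowerSeries κ (Fin (d + 1))
  haveI : (ArcLimit.arcIdeal d κ).IsPrime := ArcLimit.isPrime_arcIdeal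
  haveI : IsRegularLocalRing (MvPowerSeries (Fin (d + 1)) κ ⧸ ArcLimit.arcIdeal d κ) := ArcLimit.isRegularLocalRing_quotient_arcIdeal
  have hP1 : ringKrullDim (MvPowerSeries (Fin (d + 1)) κ ⧸ ArcLimit.arcIdeal d κ) = (1 : ℕ) := by
    rw [ArcLimit.ringKrullDim_quotient_arcIdeal, Nat.cast_one]
  let e : ↥((T.X (0 + 1)).presheaf.stalk (pt (0 + 1))) ≃+* (st (0 + 1)).1 ⧸ RingHom.ker (st (0 + 1)).2.2.2.2.1 :=
    (RingHom.quotientKerEquivOfSurjective (hclauses (0 + 1)).2.2.1).symm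
  exact false_of_pointTower_of_stage_of_bennettArc hC hcl hν he hO (0 + 1) hiso1 (RingHom.ker (st (0 + 1)).2.2.2.2.1) e J e'
    (ArcLimit.arcIdeal d κ) hP1 hJP hH

end Summit.ResolutionOfSingularities.ResolutionOfSingularities.Theorems.SigmaMaxModificationsCorridor3.IsoTailsHS

end
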